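import Mathlib
import HarnessLib
import HarnessLib.Audit
import Summits.AtomisticToContinuum.Statement
import Summits.AtomisticToContinuum.HydrodynamicLimit.Theorems.HeatBathForgettingAssembly
import Summits.AtomisticToContinuum.HydrodynamicLimit.Theorems.OneFlightGossipEngineEnergyCurrentTailsFirstPartnerObjects
import Summits.AtomisticToContinuum.HydrodynamicLimit.Theorems.OneFlightGossipEngineEnergyCurrentTailsSplitFirstPartner
import HarnessLib.Audit.Status.Attr

/-!
Route: BallwiseInvariantReferences

DORMANT since 2026-08-24T18:56:52Z (reconciler: no traction for 7 d (last activity item-evidence-added at 2026-08-17T18:35:57Z); parked, not closed — `ledger route dormant route-AtomisticToContinuum-BallwiseInvariantReferences --off` to) — unstaffed, not closed; items shared with open routes are served there. `ledger route dormant <id> --off` reactivates.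

# Route BallwiseInvariantReferences — ball-wise invariant Gibbs references make local
flux-Gibbsianity (anomalous current ≤ C·entropy) suffice for Euler

It suffices to show X = LocalFluxGibbsianity ∧ EnergyCurrentTails ∧ FastCollisionThroughput (card
local-flux-gibbsianity-ballwise; this is the D-0027 §2.1-conforming re-opening of
route-AtomisticToContinuum-BallwiseGibbsReferences, retired 2026-08-15T13:41Z `not-a-thesis` only
because its assembly concluded the Literature constant — same mechanism, same refuter-reviewed typed
statements, now with the deciding theorem `closes : LocalFluxGibbsianity → EnergyCurrentTails →
FastCollisionThroughput → BallwiseSufficiency → EntropyToFields → _root_.HydrodynamicLimit`). X1 =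
LocalFluxGibbsianity (LFG, typed, the ergodic input): under the HOMOGENEOUS, flow-invariant
canonical hard-sphere Gibbs law G_M of M+1 spheres on 𝕋³ at small reduced density σ' and Maxwellian
parameters (u, θ) in a compact box there is a tilt size β₀ > 0 such that the window pressure (M+1)⁻¹
log E_G exp(X) of the block-recentred, velocity-truncated, COLLISION-RESOLVED current functional X —
truncated kinetic mass/momentum/energy currents plus each particle's half of the collisional
momentum/energy transfer (finsum over the a.e.-finite collision times, pre-collisional left limit,
transfer smeared on the contact segment), tested against ARBITRARY fixed smooth fields A₀, A₄ : 𝕋³ →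
ℝ³, A : Fin 3 → 𝕋³ → ℝ³ of sup-norm ≤ β₀, minus the hard-sphere Euler flux of the block-averaged
truncated fields at the exact equation of state Z = hsCompressibility, rate-averaged over a micro
window τ = L(M+1)^(-1/3) — has limsup_M ≤ δ for every δ > 0 once K (velocity cut), then L (window),
then k (block) are large. By convex duality over invariant states this is LOCAL flux-Gibbsianity:
locally invariant states carry block-recentred anomalous current at most β₀⁻¹ × their specific
relative entropy — not "stationary ⇒ Gibbs" (stmt-0779) and not "anomalous current = 0 for all
tilts". X2 = EnergyCurrentTails (cubic uniform integrability of velocities under the true law,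
pre-shock; = stmt-9235 shared) and X3 = FastCollisionThroughput (vanishing throughput of collisions
involving a fast sphere, pre-shock) are the two truncation errors of X. BallwiseSufficiency (typed
implication X1 → X2 → X3 → RelEntropyVanishing) is Yau's torus Gronwall with BALL-WISE invariant
references at the local Euler parameters (entropy mismatch O(r²) + r√h per ball ⇒ H_N(t)/N = O(r²)
for every r ⇒ 0), and EntropyToFields (stmt-0769) turns RelEntropyVanishing (stmt-0766) into the
conjunct.
Lean: `LocalFluxGibbsianity ∧ EnergyCurrentTails ∧ FastCollisionThroughput`

## Assembly
Pure logic (sorry-free in the planner's Sketch.lean, `closes` and `assembly_holds`, axioms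
propext/Classical.choice/Quot.sound): BallwiseSufficiency applied to ⟨LFG, tails, throughput⟩ gives
RelEntropyVanishing, and EntropyToFields gives
`Literature.MathematicalPhysics.KineticTheory.HydrodynamicLimit`, which is the sub-problem statement
`_root_.HydrodynamicLimit` by `abbrev` (definitional unfolding, no rewriting). The deciding theorem
`closes` has exactly the Assembly's type with the route's five non-target items as hypotheses.

Rationale: WHY THIS LINE. Yau's relative entropy method (Yau1991; OllaVaradhanYau1993 Thm 2.1 with weak noise;
KipnisLandim1999 Ch. 6) needs its ergodic input in ONE place, the one-block replacement of fast
currents, which OVY feed with the classification of all finite-entropy stationary states (the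
Boltzmann hypothesis, stmt-0779) although the method consumes only its flux-level corollary
(Literature.Barriers.AtomisticToContinuum.BoltzmannHypothesisBarrierNarrow; Bernardin2014 §1.1:
"weaker or different conditions could suffice"). The card's move: keep the torus Gronwall for
H(f_t|ψ_t) but, for the one-block term only, cover 𝕋³ by macroscopic balls of radius r and apply the
entropy inequality ball by ball against the marginal of the INVARIANT homogeneous Gibbs law at the
ball's own Euler parameters; the entropy mismatch is second order, N_B(C r² + C r√h_B), and under an
invariant reference time averaging is free (the window pressure is a large-deviation functional of
the EQUILIBRIUM dynamics; Kifer1990-type duality writes it as sup_ν[β e(ν) − s(ν|g)] over invariant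
states), so only tilts of size ≤ β₀ are ever probed and the needed input shrinks from
flux-Gibbsianity for all tilts to a LINEAR anomalous-current/entropy bound around each Gibbs state
(first order = zero excess Drude weight of the projected currents, Spohn1991 §7.1, Doyon2022; second
order = bounded current response along invariant directions). Imported areas: large deviations /
convex duality for dynamical pressures, linear response around Gibbs states. Versus routes on file
and the negatives index: FluxGibbsianityLdDrude (open) types a GLOBAL-torus LD decay of bounded
one-body observables ⊥ collision invariants and localises from G_N to the non-invariant ψ_t over
kinetic windows (restart-type sufficiency, window entropy production to pay); this route fixes the
reference instead (invariant, ball-wise), which forces its technical content — a collision-resolved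
current tested against non-gradient tensor fields (gradient-tested flow differences cannot be
localised to balls with O(1) tilts), block recentring at the exact hard-sphere equation of state
(smooth local-Gibbs tilts cost entropy but carry no recentred current), and tails typed in the
fast-collision-throughput currency; none of the six refuted statements of the summit is re-wanted or
reworded.

RANKED CRUXES. #0 RelEntropyVanishing (target) — Yau's relative-entropy form of the hydrodynamic
limit (stmt-AtomisticToContinuum-0766 verbatim, the shared target of every Yau-family route): for
continuous profiles ∃ σ₀ ∀ σ < σ₀ ∀ classical hs-Euler solutions on [0,T) ∀ flow families, the
initial local Gibbs laws are probability measures and, if their fields converge at t = 0, then ∀ t <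
T there is an activity profile a_t with localGibbs(a_t, u_t, θ_t) a probability measure whose
empirical density/momentum/energy fields concentrate exponentially around (ρ, ρu, E)(t), and
klDiv(lawAt Φ_N (localGibbs a₀ u₀ θ₀) t ‖ localGibbs a_t u_t θ_t)/(N+1) → 0. (why it might fail:
entropy production ≥ cN before the first shock for some smooth data (implosion-type focusing, card
implosion-loophole) refutes every Yau-type route at once; nothing of the kind is known.) [Yau1991,
OllaVaradhanYau1993]
#2 LocalFluxGibbsianity (crux) — LOCAL FLUX-GIBBSIANITY IN PRESSURE FORM (card crux 1, finite-N
torus version; = retired stmt-6454 verbatim, refuter-reviewed rc 0). ∃ σ₀ > 0 such that for every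
parameter box 0 < σlo ≤ σ' ≤ σhi < σ₀, 0 < θlo ≤ θ ≤ θhi, |u| ≤ U there is β₀ > 0 with: for every
diameter sequence ε_M > 0 with (M+1)ε_M³ → σ'³, every family of hard-sphere flows Φ_M of M+1 spheres
on 𝕋³, all FIXED smooth test fields A₀, A₄ : 𝕋³ → ℝ³ and A : Fin 3 → 𝕋³ → ℝ³ of sup-norm ≤ β₀, and
every δ > 0: ∃ K₀ ∀ K ≥ K₀ ∃ L₀ ∀ L ≥ L₀ ∃ k₀ ∀ k ≥ k₀, limsup_M (M+1)⁻¹ log ∫ exp(X) dG_M ≤ δ,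
where G_M = particleLaw(canonicalDensity, constant activity 1, Maxwellian drift u, temperature θ) is
the homogeneous flow-invariant Gibbs law and X = τ⁻¹ [ ∫_0^τ kin ds + Σ_(collision times s ∈ (0,τ])
coll(γ(s⁻), γ(s)) − ∫_0^τ flux ds ] along γ(s) = Φ_M.flow s z, τ = L(M+1)^(-1/3) (micro window),
block radius ℓ = k(M+1)^(-1/3): kin = Σ_i 1(|v_i| ≤ K)[⟨A₀(x_i),v_i⟩ + Σ_j ⟨A_j(x_i),v_i⟩ v_i,j +
⟨A₄(x_i),v_i⟩|v_i|²/2] (truncated kinetic mass/momentum/energy currents); coll = Σ_i 1(|v_i⁻|,|v_i⁺|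
≤ K) (ε/2)∫_0^1 [Σ_j ⟨A_j(x_i − rεω_i), ω_i⟩ Δ_i,j + ⟨A₄(x_i − rεω_i), ω_i⟩ (|v_i⁺|² − |v_i⁻|²)/2]
dr, Δ_i = v_i⁺ − v_i⁻, ω_i = Δ_i/|Δ_i| (each particle's half of the collisional transfer, smeared on
the contact segment; zero for non-colliding i); flux = (M+1)∫_𝕋³ [⟨A₀,m̄⟩ + Σ_j(⟨A_j,m̄⟩ū_j + p̄
(A_j)_j) + ⟨A₄,ū⟩(ē + p̄)] dx, the hs-Euler flux of the truncated block fields (ρ̄, m̄, ē) =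
cone-kernel averages at radius ℓ of (1, v, |v|²/2) over particles with |v| ≤ K, ū = m̄/ρ̄, θ̄ =
(2/3)(ē/ρ̄ − |ū|²/2), p̄ = ρ̄ θ̄ Z(min(ρ̄,2)σ'³), Z = hsCompressibility. Dual reading (two-layer
plan): locally invariant states of the infinite dynamics near g_U carry block-recentred anomalous
current ≤ β₀⁻¹ × specific relative entropy. [difficulty: open-problem] (why it might fail: a SOFT
anomalous mode — invariant states ν_n → g_U with recentred current e ~ s^γ, γ < 1 (excess Drude
weight of stress/heat flux, or unbounded 2nd-order response) — gives limsup > 0 for all β₀, as for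
the ideal gas and d = 1 rods; or anomalous window LD of the truncated virial.) [OllaVaradhanYau1993,
Spohn1991, Bernardin2014, Kifer1990, Doyon2022, BuragoFerlegerKononenko1998]
#3 EnergyCurrentTails (crux) — UNIFORM INTEGRABILITY OF THE CUBIC ENERGY CURRENT BEFORE THE FIRST
SHOCK (= stmt-AtomisticToContinuum-9235 verbatim, shared with ExpTailStaging / WarmColdDichotomy /
OneFlightGossipEngine; the consumable corrected form of 0781): for continuous profiles ∃ σ₀ ∀ σ ∈
(0,σ₀) ∀ classical hs-Euler solutions on [0,T) ∀ flow families Φ_N, if the local Gibbs fields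
converge at t = 0 then ∀ t < T ∀ ε > 0 ∃ M ∃ N₀ ∀ N ≥ N₀ ∀ s ∈ [0,t]: E[(N+1)⁻¹ Σ_i |v_i(s)|³
1(|v_i(s)| > M)] ≤ ε. Controls the kinetic truncation error of X and the locality tails of
BallwiseSufficiency. [difficulty: open-problem] (why it might fail: the deterministic flow could
focus energy ≍ N^(2/3) on O(1) particles with non-vanishing probability — invisible to entropy
(sub-exponential LD cost of cubic tails) and to domination by Gibbs; no Povzner/maximum principle
for the N-body hard-sphere flow is known.) [NachtergaeleYau2003, OllaVaradhanYau1993, Spohn1991]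
#4 FastCollisionThroughput (crux) — VANISHING FAST-COLLISION THROUGHPUT under the true law,
pre-shock (the collisional truncation error of X, in the currency of card
apriori-tails-and-rattlers; = retired stmt-6455 verbatim): for continuous profiles ∃ σ₀ ∀ σ < σ₀ ∀
classical hs-Euler solutions on [0,T) ∀ flow families, if the local Gibbs fields converge at t = 0
then ∀ t < T ∀ η > 0 ∃ K ∃ N₀ ∀ N ≥ N₀: (N+1)^(-4/3) E[ Σ_i Σ_(collision times s ≤ t)
1(max(|v_i(s⁻)|,|v_i(s)|) > K) (1 + |v_i(s)+v_i(s⁻)|/2) |v_i(s) − v_i(s⁻)| ] ≤ η ((N+1)^(4/3) =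
order of the number of collisions on [0,t]; the summand vanishes unless i collides at s).
[difficulty: L] (why it might fail: needs collision-RATE control of fast particles under the
non-equilibrium law (contact pair densities of f_t around fast spheres); channelled fast spheres or
transient dense clusters could carry O(1) throughput at polynomially small probability, which
entropy bounds cannot see.) [BuragoFerlegerKononenko1998, GST2013, Alexander1975,
NachtergaeleYau2003]
#5 BallwiseSufficiency (crux) — THE BALL-WISE SUFFICIENCY THEOREM (card crux 2 as an implication; =
retired stmt-8346 verbatim): LocalFluxGibbsianity → EnergyCurrentTails → FastCollisionThroughput →
RelEntropyVanishing. Proof plan: Yau's Gronwall for H(f_t | ψ_t) on the torus with ψ_t the local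
Gibbs law driven by the classical solution; quadratic remainder by static LD
(LocalGibbsConcentration 0767-type); for the one-block term tile [0,t] by micro windows
L(N+1)^(-1/3), cover 𝕋³ by balls of radius r with a partition of unity χ_B, test the
collision-resolved recentred current against χ_B∇λ_t (non-gradient, sup-norm ≤ β₀ after choosing the
entropy-inequality parameter a = β₀/sup|∇λ_t|), apply the entropy inequality ball-wise to the
B⁺-marginal of f_t against the marginal of the homogeneous invariant Gibbs law of an (M+1)-sphere
system on the same unit torus with M+1 ≈ ρ_B(N+1) and parameters (σρ_B^(1/3), u_B, θ_B) on an
r-grid; entropy mismatch ≤ N_B(h_B + Cr² + Cr√h_B) + o(N_B) (second order in r; cross term via the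
static entropy inequality), Σ_B N_B h_B ≤ C_ov H + o(N) (superadditivity for near-product hard-core
references), microscopic locality of X_B over the window from deterministic light cones for
particles slower than K plus items 3–4, pressures from LFG by scaling covariance, and d(H/N)/dt ≤
C₁H/N + C₂r² + C₃r√(H/N) + δ ⇒ limsup_N H(t)/N ≤ A(t)(r² + δ) for all r, δ. Static inputs (0767,
HsEosLowDensity 0768, virial EOS identification) ride as --supports lemmas. [deps:
LocalFluxGibbsianity, EnergyCurrentTails, FastCollisionThroughput] [difficulty: XL] (why it might
fail: window locality under f_t with only cubic-UI tails, the o(N_B) hard-core boundary/ensemble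
corrections for ball marginals, the parameter/time grids and the inverse equation of state for a_t
must all close at o(N); any of these may demand more than items 3–4 supply.) [Yau1991,
OllaVaradhanYau1993, KipnisLandim1999, Spohn1991]
#9 EntropyToFields (support) — RelEntropyVanishing → HydrodynamicLimit by the entropy inequality
μ(A) ≤ (log 2 + H(μ|λ))/log(1 + 1/λ(A)) and lawAt = map (flow t) (stmt-AtomisticToContinuum-0769
verbatim, shared; concludes the Literature constant, which `_root_.HydrodynamicLimit` abbreviates
definitionally). [difficulty: provable-now] [KipnisLandim1999, Yau1991]

TWO-LAYER PLAN. Foreseen glued splits (none filed now; k ≤ 3, depth 1): LocalFluxGibbsianity ⇐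
InvariantStateLFG (duality upper bound: the window pressure is bounded by sup over locally
invariant, finite-entropy states of the infinite dynamics of [tilt − specific relative entropy];
needs the infinite-volume definitions already requested by FluxGibbsianityLdDrude / 0779) →
LinearisedLFG (zero excess Drude weight of the projected, collision-resolved currents + ℋ-valued
invariant tangents of entropy-vanishing invariant states; L² rung in the spirit of
FluxGibbsianityLdDrude's FastObservableMeanErgodic and of
Literature.Barriers.AtomisticToContinuum.MazurBoundBallisticNarrow conjunct (2)) →
SecondOrderResponse → LocalFluxGibbsianity; BallwiseSufficiency ⇐ WindowLocality →
BallMarginalMismatch → GronwallClosure. The δ^(7/3) ACOUSTIC corollary of the card (small-amplitude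
data, linearised hs-Euler, from the L² rung + a third-cumulant bound + tails) is a special-case
target to file when LinearisedLFG is typed.

KILL CRITERIA. ¬LocalFluxGibbsianity closes the route outright (close --reason
refuted:LocalFluxGibbsianity) when SUBSTANTIVE: a family of translation-invariant, flow-invariant,
finite-entropy states of infinite 3-d hard spheres at small packing approaching a Gibbs state with
anisotropic stress or heat flux ≫ their specific relative entropy (a soft anomalous mode; it also
kills 0779, FluxGibbsianityLdDrude's KineticFluxLdDecay and every mixing premise), or an N-growing
plateau in L of (M+1)⁻¹ log E_G exp(X) at fixed small β₀; a MISSTATED-class refutation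
(normalisation / degenerate instance) is repaired by a new item LocalFluxGibbsianityR and
re-certified glue. ¬FastCollisionThroughput or ¬EnergyCurrentTails with LFG standing ⇒ pivot:
restate BallwiseSufficiency with Gaussian-moment tails
(Literature.Barriers.AtomisticToContinuum.HighMomentumCutoff σ, pre-shock) as hypothesis (the route
then becomes a conditional bridge on that catalogued hypothesis). ¬RelEntropyVanishing closes this
and every Yau-family route. RelEntropyVanishing proved elsewhere moots items 5 and 9 but not LFG as
mathematics; KineticFluxLdDecay (FluxGibbsianityLdDrude) proved does NOT moot LFG (different
functional: collisional part, tensor tests, local parameters).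

NOT DECOMPOSED YET. The invariant-state (dual) form of LFG and its linear / second-order rungs (wait
for the infinite-volume definitions); the window-locality lemma, the ball-marginal mismatch estimate
with hard-core boundary layers, the r-grid of reference parameters and the time grid of test fields,
the inverse equation of state for a_t (all layer-2 children of BallwiseSufficiency); Galilean /
scaling covariance reductions (LFG is stated at unit mean density, the ball densities enter through
σ' = σρ_B^(1/3)); the static inputs 0767 / 0768 / virial EOS identification (filed in other routes,
consumed here as --supports lemmas); the acoustic corollary. Constants β₀, K₀, L₀, k₀ are
existential on purpose.

CHEAPEST FALSIFIER. (i) One page by hand: run X on the IDEAL GAS (no collisions): kin tested with a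
traceless constant shear A gives limsup_M (M+1)⁻¹ log E exp(X) = c(θ)·|A|² + O(K-tails) > 0 for
every L, k — LFG must fail there and ONLY through the missing collisions (free transport conserves
v⊗v); done while drafting: block term centred, kinetic tilt Gaussian, pressure ∝ β₀² > 0, as it must
be. (ii) Degenerate instances (the WarmColdDichotomy lesson, negatives 9236/9238): empty parameter
boxes and K ≤ 0 make LFG vacuous/zero, never false; test fields are FIXED (M-independent), so
sub-block oscillations cannot couple to unrecentred hydrodynamic fluctuations; block fields are
bounded by hard-core exclusion and |v| ≤ K; finiteness of E_G e^X at fixed M reduces to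
collision-count tails (BFK bound linear in time × total speed, Gaussian under G_M). (iii) MD (kit,
not run in this one-shot seat): N = 10³–10⁵ spheres at packing 0.05–0.2, finite-size scaling of
(M+1)⁻¹ log E_G exp(X) for a small constant shear tensor versus L: an N-growing plateau refutes LFG;
published Green–Kubo data (doi:10.1063/1.1673845) predict decay ∝ 1/L.

NUMBERS. Scales (macro units, N+1 spheres of diameter σ(N+1)^(-1/3) on the unit torus): micro length
ι = (M+1)^(-1/3); window τ = Lι (L ≍ number of mean free times × σ'²√θ); block radius kι (≈ 4k³
particles); balls of macroscopic radius r → 0 last; velocity cut K; limits N → ∞, then K, L, k in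
the order ∀δ ∃K₀ ∀K ∃L₀ ∀L ∃k₀ ∀k, then r → 0. Expected sizes given LFG: Λ_L = O(β₀²/L) +
O(L^(-3/2)) (Green–Kubo + long-time tail); entropy mismatch per ball N_B(Cr² + Cr√h_B); Gronwall
output limsup_N H(t)/N ≤ A(t) r². Compressibility cap at normalised block density 2 (2σ'³ < η₀ of
HsEosLowDensity). Items at open: 7 typed (target, 4 cruxes, 1 support, assembly); EnergyCurrentTails
= stmt-9235, RelEntropyVanishing = stmt-0766, EntropyToFields = stmt-0769 are shared by signature.

DEFINITION REQUESTS. None new. The dual form InvariantStateLFG (two-layer plan) waits for the three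
definitions already requested by FluxGibbsianityLdDrude / item 0779 (InfiniteHardSphereDynamics,
HardSphereSpecificRelEntropy, CollisionalTransferAlongFlow); the typed items inline the
collision-resolved transfer (finsum over `Literature.Analysis.FluidPDE.collisionTimes` with
`Function.leftLim`) and would shorten once CollisionalTransferAlongFlow lands.

Novelty: Searches (2026-08-15, this seat; remote OpenAlex / S2 / arXiv / zbMATH answered 429 or 0 rows —
logged in NOTES.md): `lit search --hybrid "relative entropy method localized reference measure
invariant Gibbs state hydrodynamic limit Hamiltonian system"` (12 held books: KipnisLandim1999 Ch.
6, SaintRaymond2009, DobrushinKusuoka1993, Gaspard1998 …; none localises the reference measure);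
`lit vsearch "<the ball-wise entropy inequality against invariant Gibbs at frozen parameters>"` (8
books, same); `lit frontier AtomisticToContinuum --since 2022` (21 rows: arXiv:2310.13338 heat
equation from deterministic dynamics, arXiv:2404.12234 quantitative non-gradient exclusion,
arXiv:2602.04407 after Deng–Hani–Ma — no localised-reference entropy method); `lit bridges
AtomisticToContinuum --cross any` (30 rows, none on the mechanism); `lit galaxy search … --star all`
×5 ("hydrodynamic limit": IMA vol. 9 1987, Friz–König 2019 proceedings; four mechanism phrases: 0)
and `--star pdf --mode intelligent` (8 rows: Oberwolfach LD report 1992, Dettmann Lorentz gas …,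
none relevant); plus the card's audited searches (OllaVaradhanYau1993 pp. 3, 15–18; Spohn1991 pp.
11, 40–46, 53; crossref sweeps) and the retired route's (galaxy "relative entropy method":
arXiv:2401.17651 Euler–Poisson). Read in full for overlap: FluxGibbsianityLdDrude (open),
KineticWindows, FirstFailureBlowup, ExpTailStaging.
Nearest prior art found: OllaVaradhanYau1993 §3–4 (Thm 3.10: the classification is used only for
currents);  [refs: 10.2307/2001571, 10.1007/s00220-022-04310-3, 2310.13338, 2404.12234, 2602.04407, 2401.17651, 1407.7023, doi:10.2307/2001571, doi:10.1007/s00220-022-04310-3, KipnisLandim1999, SaintRaymond2009, DobrushinKusuoka1993, Gaspard1998, OllaVaradhanYau1993, Spohn1991, Bernardin2014, Kifer1990, Doyon2022]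

Barriers (technique_class: relative-entropy linear-response large-deviations): - technique_class: relative-entropy linear-response large-deviations
- Literature.Barriers.AtomisticToContinuum.BoltzmannHypothesisBarrier: weakened, not evaded: the
input is "locally invariant states carry anomalous current ≤ C × entropy" (LFG), strictly weaker
than "stationary ⇒ Gibbs mixture" (0779) and than flux-Gibbsianity for all tilts; the barrier's
formal kernel (ideal gas, arbitrary velocity law h: anomalous stress ~ |h−M| at entropy cost ~
|h−M|²) is exactly a case where LFG is false, for the right reason (no collisions); the bet is that
near-equilibrium current rigidity of 3-d hard spheres is provable where classification is not.
- Literature.Barriers.AtomisticToContinuum.BoltzmannHypothesisBarrierNarrow: adopted as frame (the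
method consumes a flux-level closure, scope caveat (b): a proof of it for hard spheres at small
reduced density evades the barrier); LFG is a local, typed, finite-N form of that closure including
the collisional transfer.
- Literature.Barriers.AtomisticToContinuum.MacroErgodicityBarrier: applies in spirit (same missing
input); Bernardin's "weaker conditions" clause is instantiated; no sector condition or spectral gap
at Euler scale is asked.
- Literature.Barriers.AtomisticToContinuum.HighMomentumCutoffBarrier: it does not evade it; the bet
is items 3–4 (cubic UI + fast-collision throughput, pre-shock, in the mean) — weaker than
Nachtergaele–Yau's Gaussian II.1 and exactly what the truncated functional needs; LFG's exponential
moments are take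

History (route lifecycle, newest last):
- 2026-08-24T18:56:52Z · DORMANT — reconciler: no traction for 7 d (last activity item-evidence-added at 2026-08-17T18:35:57Z); parked, not closed — `ledger route dormant route-AtomisticToContinu (operator:999:4147316)

sub-problem: HydrodynamicLimit · status: dormant · opened planner-plancard-AtomisticToContinuum-Hydrody-86786698-g2-0 2026-08-15T18:57:07Z · rev 4 · ledger route-AtomisticToContinuum-BallwiseInvariantReferences
GENERATED by the gate from the ledger (D-0016/17). Provers cite these decls: `theorem foo : Summit.AtomisticToContinuum.HydrodynamicLimit.Theses.BallwiseInvariantReferences.<Decl> := …` in Summits/AtomisticToContinuum/HydrodynamicLimit/Theorems/<Name>.lean.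
-/

namespace Summit.AtomisticToContinuum.HydrodynamicLimit.Theses.BallwiseInvariantReferences

open scoped BigOperators Topology Manifold Classical MeasureTheory ProbabilityTheory Matrix InnerProductSpace ComplexConjugate ContinuousMap
open Filter Set Function TopologicalSpace MeasureTheory

attribute [summit_statement] _root_.HydrodynamicLimit

/-- item stmt-AtomisticToContinuum-0766 · target · rank 0 · open · by planner
why it might fail: entropy production ≥ cN before the first shock for some smooth data (implosion-type focusing, card implosion-loophole) refutes every Yau-type route at once; nothing of the kind is known.
sources: Yau1991, OllaVaradhanYau1993
[target] X_RE: for all continuous profiles ∃ σ₀ ∀ σ<σ₀ ∀ classical hs-Euler solutions on [0,T) ∀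
flows: the initial local Gibbs laws are probability measures and, if their fields converge at t=0,
then ∀ t<T ∃ activity profile a_t such that the reference local Gibbs law (a_t, u_t, θ_t) is a
probability measure whose empirical density/momentum/energy fields concentrate exponentially (≤ C
e^{-(N+1)/C}) around (ρ,ρu,E)(t), and klDiv(lawAt Φ_N (localGibbs a₀u₀θ₀) t ‖ localGibbs a_t u_t
θ_t)/(N+1) → 0. Yau1991; OllaVaradhanYau1993 Thm 1.1 (with noise). -/
@[route_item "route-AtomisticToContinuum-BallwiseInvariantReferences", crux]
def RelEntropyVanishing : Prop :=
  ∀ (a₀ θ₀ : Literature.MathematicalPhysics.KineticTheory.T3 → ℝ) (u₀ : Literature.MathematicalPhysics.KineticTheory.T3 → Literature.MathematicalPhysics.KineticTheory.V3), Continuous a₀ → Continuous θ₀ → Continuous u₀ → (∀ x, 0 < a₀ x) → (∀ x, 0 < θ₀ x) → ∃ σ₀ : ℝ, 0 < σ₀ ∧ ∀ σ : ℝ, 0 < σ → σ < σ₀ → ∀ (T : ℝ) (ρ θ : ℝ → Literature.MathematicalPhysics.KineticTheory.T3 → ℝ) (u : ℝ → Literature.MathematicalPhysics.KineticTheory.T3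 → Literature.MathematicalPhysics.KineticTheory.V3), Literature.MathematicalPhysics.KineticTheory.IsHardSphereEulerSolution σ T ρ u θ → ∀ Φ : (N : ℕ) → Literature.Analysis.FluidPDE.HardSphereFlow (Literature.Analysis.FluidPDE.Torus.geometry (Fin 3)) (Literature.MathematicalPhysics.KineticTheory.hsDiameter σ N) (N + 1), (∀ N, MeasureTheory.IsProbabilityMeasure (Literature.MathematicalPhysics.KineticTheory.localGibbsLaw σ a₀ u₀ θ₀ N (Φ N))) ∧ (Literature.MathematicalPhysics.KineticTheory.TendstoHydroFieldsAt (fun N => Literature.MathematicalPhysics.KineticTheory.localGibbsLaw σ a₀ u₀ θ₀ N (Φ N)) Φ ρ u θ 0 → ∀ t ∈ Set.Ico 0 T, ∃ a : Literature.MathematicalPhysics.KineticTheory.T3 → ℝ, (∀ N, MeasureTheory.IsProbabilityMeasure (Literature.MathematicalPhysics.KineticTheory.localGibbsLaw σ a (u t) (θ t) N (Φ N))) ∧ (∀ χ : Literature.MathematicalPhysics.KineticTheory.T3 → ℝ, Continuous χ → ∀ δ : ℝ, 0 < δ → ∃ C : ℝ, 0 < C ∧ ∀ N : ℕ, Literature.MathematicalPhysics.KineticTheory.localGibbsLaw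 σ a (u t) (θ t) N (Φ N) {z | δ < |Literature.MathematicalPhysics.KineticTheory.empiricalDensityField z χ - ∫ x, χ x * ρ t x|} ≤ ENNReal.ofReal (C * Real.exp (-(C⁻¹ * (N + 1)))) ∧ Literature.MathematicalPhysics.KineticTheory.localGibbsLaw σ a (u t) (θ t) N (Φ N) {z | δ < ‖Literature.MathematicalPhysics.KineticTheory.empiricalMomentumField z χ - ∫ x, (χ x * ρ t x) • u t x‖} ≤ ENNReal.ofReal (C * Real.exp (-(C⁻¹ * (N + 1)))) ∧ Literature.MathematicalPhysics.KineticTheory.localGibbsLaw σ a (u t) (θ t) N (Φ N) {z | δ < |Literature.MathematicalPhysics.KineticTheory.empiricalEnergyField z χ - ∫ x, χ x * Literature.MathematicalPhysics.KineticTheory.totalEnergyDensity (ρ t x) (u t x) (θ t x)|} ≤ ENNReal.ofReal (C * Real.exp (-(C⁻¹ * (N + 1))))) ∧ Filter.Tendsto (fun N : ℕ => InformationTheory.klDiv ((Φ N).lawAt (Literature.MathematicalPhysics.KineticTheory.localGibbsLaw σ a₀ u₀ θ₀ N (Φ N)) t) (Literature.MathematicalPhysics.KineticTheory.localGibbsLaw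 σ a (u t) (θ t) N (Φ N)) / ((N : ENNReal) + 1)) Filter.atTop (nhds 0))

/-- item stmt-AtomisticToContinuum-13021 · crux · rank 2 · open · by planner
why it might fail: a SOFT anomalous mode — invariant states ν_n → g_U with recentred current e ~ s^γ, γ < 1 (excess Drude weight of stress/heat flux, or unbounded 2nd-order response) — gives limsup > 0 for all β₀, as for the ideal gas and d = 1 rods; or anomalous window LD of the truncated virial.
sources: OllaVaradhanYau1993, Spohn1991, Bernardin2014, Kifer1990, Doyon2022, BuragoFerlegerKononenko1998
[crux] LOCAL FLUX-GIBBSIANITY IN PRESSURE FORM (card crux 1, finite-N torus version; = retired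
stmt-6454 verbatim, refuter-reviewed rc 0). ∃ σ₀ > 0 such that for every parameter box 0 < σlo ≤ σ'
≤ σhi < σ₀, 0 < θlo ≤ θ ≤ θhi, |u| ≤ U there is β₀ > 0 with: for every diameter sequence ε_M > 0
with (M+1)ε_M³ → σ'³, every family of hard-sphere flows Φ_M of M+1 spheres on 𝕋³, all FIXED smooth
test fields A₀, A₄ : 𝕋³ → ℝ³ and A : Fin 3 → 𝕋³ → ℝ³ of sup-norm ≤ β₀, and every δ > 0: ∃ K₀ ∀ K ≥
K₀ ∃ L₀ ∀ L ≥ L₀ ∃ k₀ ∀ k ≥ k₀, limsup_M (M+1)⁻¹ log ∫ exp(X) dG_M ≤ δ, where G_M =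
particleLaw(canonicalDensity, constant activity 1, Maxwellian drift u, temperature θ) is the
homogeneous flow-invariant Gibbs law and X = τ⁻¹ [ ∫_0^τ kin ds + Σ_(collision times s ∈ (0,τ])
coll(γ(s⁻), γ(s)) − ∫_0^τ flux ds ] along γ(s) = Φ_M.flow s z, τ = L(M+1)^(-1/3) (micro window),
block radius ℓ = k(M+1)^(-1/3): kin = Σ_i 1(|v_i| ≤ K)[⟨A₀(x_i),v_i⟩ + Σ_j ⟨A_j(x_i),v_i⟩ v_i,j +
⟨A₄(x_i),v_i⟩|v_i|²/2] (truncated kinetic mass/momentum/energy currents); coll = Σ_i 1(|v_i⁻|,|v_i⁺|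
≤ K) (ε/2)∫_0^1 [Σ_j ⟨A_j(x_i − rεω_i), ω_i⟩ Δ_i,j + ⟨A₄(x_i − rεω_i), ω_i⟩ (|v_i⁺|² − |v_i⁻|²)/2]
dr, Δ_i = v_i⁺ − v_i⁻, ω_i = Δ_i/|Δ_i| (ea -/
@[route_item "route-AtomisticToContinuum-BallwiseInvariantReferences", crux]
def LocalFluxGibbsianity : Prop :=
  ∃ σ₀ : ℝ, 0 < σ₀ ∧ ∀ (σlo σhi θlo θhi U : ℝ), 0 < σlo → σhi < σ₀ → 0 < θlo → ∃ β₀ : ℝ, 0 < β₀ ∧ ∀ σ' ∈ Set.Icc σlo σhi, ∀ θ ∈ Set.Icc θlo θhi, ∀ u : EuclideanSpace ℝ (Fin 3), ‖u‖ ≤ U → ∀ ε : ℕ → ℝ, (∀ M, 0 < ε M) → Filter.Tendsto (fun M : ℕ => ((M : ℝ) + 1) * ε M ^ 3) Filter.atTop (nhds (σ' ^ 3)) → ∀ Φ : (M : ℕ) → Literature.Analysis.FluidPDE.HardSphereFlow (Literature.Analysis.FluidPDE.Torus.geometry (Fin 3)) (ε M) (M + 1), ∀ (A₀ A₄ : UnitAddTorus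 (Fin 3) → EuclideanSpace ℝ (Fin 3)) (A : Fin 3 → UnitAddTorus (Fin 3) → EuclideanSpace ℝ (Fin 3)), Literature.Analysis.FunctionSpaces.Torus.IsSmooth A₀ → Literature.Analysis.FunctionSpaces.Torus.IsSmooth A₄ → (∀ k, Literature.Analysis.FunctionSpaces.Torus.IsSmooth (A k)) → (∀ x, ‖A₀ x‖ ≤ β₀) → (∀ x, ‖A₄ x‖ ≤ β₀) → (∀ k x, ‖A k x‖ ≤ β₀) → ∀ δ : ℝ, 0 < δ → ∃ K₀ : ℝ, ∀ K ≥ K₀, ∃ L₀ : ℝ, ∀ L ≥ L₀, ∃ k₀ : ℝ, ∀ k ≥ k₀, Filter.limsup (fun M : ℕ => let τ : ℝ := L * ((M : ℝ) + 1) ^ (-(1 / 3 : ℝ)); let bk : UnitAddTorus (Fin 3) → UnitAddTorus (Fin 3) → ℝ := fun x y => 3 / (Real.pi * (k * ((M : ℝ) + 1) ^ (-(1 / 3 : ℝ))) ^ 3) * max 0 (1 - Literature.Analysis.FluidPDE.Torus.euclidDist x y / (k * ((M : ℝ) + 1) ^ (-(1 / 3 : ℝ)))); let kin : (Fin (M +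 1) → UnitAddTorus (Fin 3) × EuclideanSpace ℝ (Fin 3)) → ℝ := fun z => ∑ i, if ‖(z i).2‖ ≤ K then ⟪A₀ (z i).1, (z i).2⟫_ℝ + (∑ j, ⟪A j (z i).1, (z i).2⟫_ℝ * (z i).2 j) + ⟪A₄ (z i).1, (z i).2⟫_ℝ * ‖(z i).2‖ ^ 2 / 2 else 0; let coll : (Fin (M + 1) → UnitAddTorus (Fin 3) × EuclideanSpace ℝ (Fin 3)) → (Fin (M + 1) → UnitAddTorus (Fin 3) × EuclideanSpace ℝ (Fin 3)) → ℝ := fun zl zr => ∑ i, (let Δ : EuclideanSpace ℝ (Fin 3) := (zr i).2 - (zl i).2; let ω : EuclideanSpace ℝ (Fin 3) := ‖Δ‖⁻¹ • Δ; if ‖(zl i).2‖ ≤ K ∧ ‖(zr i).2‖ ≤ K then ε M / 2 * ∫ r in (0 : ℝ)..1, ((∑ j, ⟪A j ((zr i).1 + Literature.Analysis.FunctionSpaces.Torus.proj (-(r * ε M) • ω)), ω⟫_ℝ * Δ j) + ⟪A₄ ((zr i).1 + Literature.Analysis.FunctionSpaces.Torus.proj (-(r * ε M) • ω)), ω⟫_ℝ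 * (‖(zr i).2‖ ^ 2 - ‖(zl i).2‖ ^ 2) / 2) else 0); let flux : (Fin (M + 1) → UnitAddTorus (Fin 3) × EuclideanSpace ℝ (Fin 3)) → ℝ := fun z => ((M : ℝ) + 1) * ∫ x, (let ρ : ℝ := ((M : ℝ) + 1)⁻¹ * ∑ i, (if ‖(z i).2‖ ≤ K then bk x (z i).1 else 0); let m : EuclideanSpace ℝ (Fin 3) := ((M : ℝ) + 1)⁻¹ • ∑ i, (if ‖(z i).2‖ ≤ K then bk x (z i).1 • (z i).2 else 0); let e : ℝ := ((M : ℝ) + 1)⁻¹ * ∑ i, (if ‖(z i).2‖ ≤ K then bk x (z i).1 * ‖(z i).2‖ ^ 2 / 2 else 0); let w : EuclideanSpace ℝ (Fin 3) := ρ⁻¹ • m; let p : ℝ := ρ * (2 / 3 * (e / ρ - ‖w‖ ^ 2 / 2)) * Literature.MathematicalPhysics.KineticTheory.hsCompressibility (min ρ 2 * σ' ^ 3); ⟪A₀ x, m⟫_ℝ + (∑ j, (⟪A j x, m⟫_ℝ * w j + p * A j x j)) + ⟪A₄ x, w⟫_ℝ * (e + p)); ((((M : ℝ) + 1)⁻¹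 : ℝ) : EReal) * ENNReal.log (∫⁻ z, ENNReal.ofReal (Real.exp (τ⁻¹ * ((∫ s in (0 : ℝ)..τ, kin ((Φ M).flow s z)) + (∑ᶠ s ∈ Literature.Analysis.FluidPDE.collisionTimes (Literature.Analysis.FluidPDE.Torus.geometry (Fin 3)) (ε M) (fun s => (Φ M).flow s z) ∩ Set.Ioc 0 τ, coll (Function.leftLim (fun s => (Φ M).flow s z) s) ((Φ M).flow s z)) - ∫ s in (0 : ℝ)..τ, flux ((Φ M).flow s z)))) ∂(Literature.Analysis.FluidPDE.particleLaw (Φ M) (Literature.Analysis.FluidPDE.canonicalDensity (Literature.Analysis.FluidPDE.Torus.geometry (Fin 3)) (ε M) (M + 1) (Literature.MathematicalPhysics.KineticTheory.localGibbsProfile (fun _ => 1) (fun _ => u) (fun _ => θ)))))) Filter.atTop ≤ (δ : EReal)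

/-- item stmt-AtomisticToContinuum-9235 · crux · rank 3 · SPLIT (gen 1) into FirstPartnerFloorMeso, FirstPartnerRealisedShare, EnergyFluxCeilingWindows + glue Summit.AtomisticToContinuum.HydrodynamicLimit.Theorems.QuarticSchurLedger.EnergyCurrentTails_of_firstPartner · direct attempts still welcome (low priority) · by planner
why it might fail: the deterministic flow could focus energy ≍ N^(2/3) on O(1) particles with non-vanishing probability — invisible to entropy (sub-exponential LD cost of cubic tails) and to domination by Gibbs; no Povzner/maximum principle for the N-body hard-sphere flow is known.
sources: NachtergaeleYau2003, OllaVaradhanYau1993, Spohn1991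
[crux] UNIFORM INTEGRABILITY OF THE CUBIC ENERGY CURRENT BEFORE THE FIRST SHOCK (shared typed crux
stmt-AtomisticToContinuum-3655 of route KineticWindows; the card's "cubic UI" conjunct X_T): for
continuous profiles ∃ σ₀ ∀ σ ∈ (0,σ₀) ∀ classical hs-Euler solutions on [0,T) ∀ flow families, if
the local Gibbs fields converge at t = 0 then ∀ t < T ∀ ε > 0 ∃ M ∃ N₀ ∀ N ≥ N₀ ∀ s ∈ [0,t]:
E[(N+1)⁻¹ Σ_i |v_i(s)|³ 1{|v_i(s)| > M}] ≤ ε. Needed here only for the energy equation (heat flux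
and (E+p)u): the quadratic momentum closure needs no tail input in this route (energy conservation +
the o(N) entropy bootstrap exclude sparse energy concentration, whose local-Gibbs cost is
extensive), but cubic mass on a vanishing fraction of particles has SUB-extensive cost. [difficulty:
open-problem] -/
@[route_item "route-AtomisticToContinuum-BallwiseInvariantReferences", crux]
def EnergyCurrentTails : Prop :=
  ∀ (a₀ θ₀ : Literature.MathematicalPhysics.KineticTheory.T3 → ℝ) (u₀ : Literature.MathematicalPhysics.KineticTheory.T3 → Literature.MathematicalPhysics.KineticTheory.V3), Continuous a₀ → Continuous θ₀ → Continuous u₀ → (∀ x, 0 < a₀ x) → (∀ x, 0 < θ₀ x) → ∃ σ₀ : ℝ, 0 < σ₀ ∧ ∀ σ : ℝ, 0 < σ → σ < σ₀ → ∀ (T : ℝ) (ρ θ : ℝ → Literature.MathematicalPhysics.KineticTheory.T3 → ℝ) (u : ℝ → Literature.MathematicalPhysics.KineticTheory.T3 → Literature.MathematicalPhysics.KineticTheory.V3), Literature.MathematicalPhysics.KineticTheory.IsHardSphereEulerSolution σ T ρ u θ → ∀ Φ : (N : ℕ) → Literature.Analysis.FluidPDE.HardSphereFlow (Literature.Analysis.FluidPDE.Torus.geometry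 (Fin 3)) (Literature.MathematicalPhysics.KineticTheory.hsDiameter σ N) (N + 1), Literature.MathematicalPhysics.KineticTheory.TendstoHydroFieldsAt (fun N => Literature.MathematicalPhysics.KineticTheory.localGibbsLaw σ a₀ u₀ θ₀ N (Φ N)) Φ ρ u θ 0 → ∀ t ∈ Set.Ico 0 T, ∀ ε : ℝ, 0 < ε → ∃ M : ℝ, ∃ N₀ : ℕ, ∀ N : ℕ, N₀ ≤ N → ∀ s ∈ Set.Icc 0 t, ∫⁻ z, ENNReal.ofReal (((N : ℝ) + 1)⁻¹ * ∑ i : Fin (N + 1), Set.indicator {v : Literature.MathematicalPhysics.KineticTheory.V3 | M < ‖v‖} (fun v => ‖v‖ ^ 3) (((Φ N).flow s z i).2)) ∂(Literature.MathematicalPhysics.KineticTheory.localGibbsLaw σ a₀ u₀ θ₀ N (Φ N)) ≤ ENNReal.ofReal ε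

-- parent: EnergyCurrentTails · child (gen 1)
/--     item stmt-AtomisticToContinuum-18198 · crux · rank 301 · open
    parent: EnergyCurrentTails · by operator
    why it might fail: Corridors: a positive ‖v‖⁴-fraction of lab-fast spheres aimed into mesoscopic voids at some r ≤ T (co-moving platoons, own wakes re-entered after head-on fast–fast exchange, jets); T is Euler-free; no tool bounds the environment of a RARE fast sphere under the evolved law; entropy affords it (o(N)).
    sources: GST2013, Lanford1975, OllaVaradhanYau1993, NachtergaeleYau2003, CercignaniIllnerPulvirenti1994, Literature.Barriers.AtomisticToContinuum.HighMomentumCutoffBarrierNarrow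
[crux] STATIC MESOSCOPIC FIRST-PARTNER FLOOR (child 1 of EnergyCurrentTails; crux-strategist s2
split 2026-08-17; VERBATIM the registered open stub `stub_firstPartnerFloor` :
`…Theorems.EnergyCurrentTailsFirstPartner.FirstPartnerFloorMeso` of line quartic-schur-ledger, seat
c6 reshape B, Iff.rfl). Along the flow from local Gibbs data, for every horizon T > 0 (Euler-free)
and flow family: ∃ K₀ ≥ 0, K₁, τ₀ > 0 such that for every look-ahead ratio 0 < τ₁ ≤ τ₀ there are c >
0, N₀ with, for N ≥ N₀ and r ∈ [0,T]: c·σ²(N+1)^{1/3}·τ₁h_N·E_{λ_r}[(N+1)⁻¹ Σ_{‖v_i‖>K₀} ‖v_i‖⁴] ≤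
E_{λ_r}[firstPartnerSum at look-ahead τ₁h_N, quartic mixing mark 𝟙{K₀<‖v‖,
‖w‖≤K₁}(N+1)⁻¹·2‖v′‖²‖w′‖²], h_N = (N+1)^{-1/3} — in the ‖v‖⁴-weighted mean a lab-fast sphere has,
with probability ≥ c·τ₁σ², a THERMAL first free-flight partner within τ₁ kinetic times whose
predicted elastic encounter has non-degenerate Povzner gain. A statement about the (1+1)-body
structure of the EVOLVED law at ONE time, at the mesoscopic scale τ₁h_N‖v−w‖ ≫ ε_N (never at
contact); the ONLY floor left in the line (every dynamic lower bound has been converted into this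
fixed-time statement plus ceilings); beyond every entropy / domination / L -/
@[route_item "route-AtomisticToContinuum-BallwiseInvariantReferences", crux]
def FirstPartnerFloorMeso : Prop :=
  ∀ (a₀ θ₀ : Literature.MathematicalPhysics.KineticTheory.T3 → ℝ) (u₀ : Literature.MathematicalPhysics.KineticTheory.T3 → Literature.MathematicalPhysics.KineticTheory.V3), Continuous a₀ → Continuous θ₀ → Continuous u₀ → (∀ x, 0 < a₀ x) → (∀ x, 0 < θ₀ x) → ∃ σ₀ : ℝ, 0 < σ₀ ∧ ∀ σ : ℝ, 0 < σ → σ < σ₀ → ∀ T : ℝ, 0 < T → ∀ Φ : ((N : ℕ) → Literature.Analysis.FluidPDE.HardSphereFlow (Literature.Analysis.FluidPDE.Torus.geometry (Fin 3)) (Literature.MathematicalPhysics.KineticTheory.hsDiameter σ N) (N + 1)), ∃ K₀ : ℝ, 0 ≤ K₀ ∧ ∃ K₁ : ℝ, ∃ τ₀ : ℝ, 0 < τ₀ ∧ ∀ τ₁ : ℝ, 0 < τ₁ → τ₁ ≤ τ₀ → ∃ c : ℝ, 0 < c ∧ ∃ N₀ : ℕ, ∀ N : ℕ, N₀ ≤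 N → ∀ r : ℝ, 0 ≤ r → r ≤ T → ENNReal.ofReal (c * (σ ^ 2 * ((N + 1 : ℕ) : ℝ) ^ ((1 : ℝ) / 3)) * (τ₁ * ((N : ℝ) + 1) ^ (-(1 / 3 : ℝ)))) * (∫⁻ z, ENNReal.ofReal (Summit.AtomisticToContinuum.HydrodynamicLimit.Theorems.EnergyCurrentTailsFirstPartner.fastQuarticAvg N K₀ ((Φ N).flow r z)) ∂(Literature.MathematicalPhysics.KineticTheory.localGibbsLaw σ a₀ u₀ θ₀ N (Φ N))) ≤ ∫⁻ z, ENNReal.ofReal (Summit.AtomisticToContinuum.HydrodynamicLimit.Theorems.EnergyCurrentTailsFirstPartner.firstPartnerSum (Literature.MathematicalPhysics.KineticTheory.hsDiameter σ N) (τ₁ * ((N : ℝ) + 1) ^ (-(1 / 3 : ℝ))) ((Φ N).flow r z) r (Summit.AtomisticToContinuum.HydrodynamicLimit.Theorems.EnergyCurrentTailsFirstPartner.mixMark N K₀ K₁)) ∂(Literature.MathematicalPhysics.KineticTheory.localGibbsLaw σ a₀ u₀ θ₀ N (Φ N))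

-- parent: EnergyCurrentTails · child (gen 1)
/--     item stmt-AtomisticToContinuum-18199 · crux · rank 302 · open
    parent: EnergyCurrentTails · by operator
    why it might fail: Dynamical over-production of three-body encounters around fast spheres under the evolved law (triple near-contacts, transient dense micro-clusters, a fast sphere entering a compressed post-shock layer; T Euler-free) could drive the undisturbed share to 0 along a subsequence for every τ₀.
    sources: GST2013, Lanford1975, CercignaniIllnerPulvirenti1994, OllaVaradhanYau1993, Spohn1991
[crux] FIRST-PARTNER REALISED SHARE (child 2 of EnergyCurrentTails; crux-strategist s2 split
2026-08-17; VERBATIM the registered open stub `stub_firstPartnerDisturbanceCeiling` :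
`…Theorems.EnergyCurrentTailsFirstPartner.FirstPartnerRealisedShare`, seat c6 reshape B, Iff.rfl).
For all thresholds K₀, K₁ there are τ₀ > 0, a share constant A ≥ 1 and N₀ such that for N ≥ N₀,
every look-ahead 0 < Δ ≤ τ₀h_N and every 0 ≤ r with r + Δ ≤ T (T Euler-free): E_{λ}[firstPartnerSum
predicted at time r] ≤ A · E_{λ}[realisedFirstSum over (r, r+Δ]] — in the
quartic-mixing-mark-weighted mean at least the fraction 1/A of the first free-flight encounters
predicted at time r within the look-ahead actually happen undisturbed (neither sphere is hit by a
third one before the predicted contact). Pathwise the disturbed part needs a THIRD sphere to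
collide, before the predicted contact (which comes after ≲ min(Δ, λ_mfp/‖v‖)), with the thermal
partner or — itself freshly deflected — with the fast sphere: conditional probability ≲
C·min(σ²τ₀(1+K₁), v_th/‖v‖) under one-sided chaos. A short-window CEILING of Enskog type with ONE
RARE participant — the species of stmt-AtomisticToContinuum-16939 (JeansLoadedDice. -/
@[route_item "route-AtomisticToContinuum-BallwiseInvariantReferences", crux]
def FirstPartnerRealisedShare : Prop :=
  ∀ (a₀ θ₀ : Literature.MathematicalPhysics.KineticTheory.T3 → ℝ) (u₀ : Literature.MathematicalPhysics.KineticTheory.T3 → Literature.MathematicalPhysics.KineticTheory.V3), Continuous a₀ → Continuous θ₀ → Continuous u₀ → (∀ x, 0 < a₀ x) → (∀ x, 0 < θ₀ x) → ∃ σ₀ : ℝ, 0 < σ₀ ∧ ∀ σ : ℝ, 0 < σ → σ < σ₀ → ∀ T : ℝ, 0 < T → ∀ Φ : ((N : ℕ) → Literature.Analysis.FluidPDE.HardSphereFlow (Literature.Analysis.FluidPDE.Torus.geometry (Fin 3)) (Literature.MathematicalPhysics.KineticTheory.hsDiameter σ N) (N + 1)), ∀ K₀ K₁ : ℝ, ∃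 τ₀ : ℝ, 0 < τ₀ ∧ ∃ A : ℝ, 1 ≤ A ∧ ∃ N₀ : ℕ, ∀ N : ℕ, N₀ ≤ N → ∀ Δ : ℝ, 0 < Δ → Δ ≤ τ₀ * ((N : ℝ) + 1) ^ (-(1 / 3 : ℝ)) → ∀ r : ℝ, 0 ≤ r → r + Δ ≤ T → (∫⁻ z, ENNReal.ofReal (Summit.AtomisticToContinuum.HydrodynamicLimit.Theorems.EnergyCurrentTailsFirstPartner.firstPartnerSum (Literature.MathematicalPhysics.KineticTheory.hsDiameter σ N) Δ ((Φ N).flow r z) r (Summit.AtomisticToContinuum.HydrodynamicLimit.Theorems.EnergyCurrentTailsFirstPartner.mixMark N K₀ K₁)) ∂(Literature.MathematicalPhysics.KineticTheory.localGibbsLaw σ a₀ u₀ θ₀ N (Φ N))) ≤ ENNReal.ofReal A * (∫⁻ z, ENNReal.ofReal (Summit.AtomisticToContinuum.HydrodynamicLimit.Theorems.EnergyCurrentTailsFirstPartner.realisedFirstSum (Literature.MathematicalPhysics.KineticTheory.hsDiameter σ N) Δ (fun u => (Φ N).flow u z) r (Summit.AtomisticToContinuum.HydrodynamicLimit.Theorems.EnergyCurrentTailsFirstPartner.mixMark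 N K₀ K₁)) ∂(Literature.MathematicalPhysics.KineticTheory.localGibbsLaw σ a₀ u₀ θ₀ N (Φ N)))

-- parent: EnergyCurrentTails · child (gen 1)
/--     item stmt-AtomisticToContinuum-18200 · crux · rank 303 · open
    parent: EnergyCurrentTails · by operator
    why it might fail: C must be uniform over all windows up to an Euler-free T: over-production of fast–fast / fast–dense encounters (hot micro-clusters, focusing trees) or N-growing temperature contrast breaks it; ∫ρ²m₂² vs (∫ρm₂)(∫ρm₃) is not a Hölder pair, so even chaos needs comparable moment profiles.
    sources: OllaVaradhanYau1993, NachtergaeleYau2003, CercignaniIllnerPulvirenti1994, Spohn1991, Literature.Barriers.AtomisticToContinuum.HighMomentumCutoffBarrierNarrow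
[crux] BULK BILINEAR ENERGY-FLUX CEILING ON ALL WINDOWS (child 3 of EnergyCurrentTails;
crux-strategist s2 split 2026-08-17; VERBATIM the registered open stub
`stub_energyFluxCeilingWindows` (S2a″) of line quartic-schur-ledger — also the third child of the s1
SPLIT-REQUEST and of the c5/c6 children files). For every horizon T > 0 (Euler-free) and flow family
∃ C ≥ 0, N₀ ∀ N ≥ N₀ ∀ 0 ≤ s ≤ s′ ≤ T: E_λ[(N+1)⁻¹ Σ_{collisions in (s,s′]} ‖v₁⁻‖²‖v₂⁻‖²] ≤
C·σ²(N+1)^{1/3}(s′−s) · sup_{r∈[s,s′]} E_λ[m₂(r)] · sup_{r∈[s,s′]} E_λ[m₃(r)], m_k =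
(N+1)⁻¹Σ_i‖v_i‖^k — the one-sided Stosszahlansatz as an UPPER bound for the one bilinear
pre-collisional mark that the quartic gain lemma produces (quartic_collision_gain_le). TYPED
PRODUCER: stmt-AtomisticToContinuum-16939 `JeansLoadedDice.ContactIntensityDominationOneRare` at ψ =
‖·‖², k = 2, through the LANDED dock `…QuarticSchurLedger.stub_energyFluxCeilingWindows_of_oneRare`
(p139311) — so this child closes the moment 16939 does; it is filed separately because it is
strictly weaker (one fixed polynomial mark, bulk moments on the right) and is what the glue
consumes. Certified: rung 0 for all N ≥ 1 and all windows (stub_energyFluxCeilingRung0 p102898 -/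
@[route_item "route-AtomisticToContinuum-BallwiseInvariantReferences", crux]
def EnergyFluxCeilingWindows : Prop :=
  ∀ (a₀ θ₀ : Literature.MathematicalPhysics.KineticTheory.T3 → ℝ) (u₀ : Literature.MathematicalPhysics.KineticTheory.T3 → Literature.MathematicalPhysics.KineticTheory.V3), Continuous a₀ → Continuous θ₀ → Continuous u₀ → (∀ x, 0 < a₀ x) → (∀ x, 0 < θ₀ x) → ∃ σ₀ : ℝ, 0 < σ₀ ∧ ∀ σ : ℝ, 0 < σ → σ < σ₀ → ∀ T : ℝ, 0 < T → ∀ Φ : ((N : ℕ) → Literature.Analysis.FluidPDE.HardSphereFlow (Literature.Analysis.FluidPDE.Torus.geometry (Fin 3)) (Literature.MathematicalPhysics.KineticTheory.hsDiameter σ N) (N + 1)), ∃ C : ℝ, 0 ≤ C ∧ ∃ N₀ : ℕ, ∀ N : ℕ, N₀ ≤ N → ∀ s s' : ℝ, 0 ≤ s → s ≤ s' → s' ≤ T → (∫⁻ z, ENNReal.ofReal (((N : ℝ) + 1)⁻¹ * (Φ N).collisionSum (Set.Ioc s s') (fun col => ‖col.preVel.1‖ ^ 2 * ‖col.preVel.2‖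 ^ 2) z) ∂(Literature.MathematicalPhysics.KineticTheory.localGibbsLaw σ a₀ u₀ θ₀ N (Φ N))) ≤ ENNReal.ofReal (C * (σ ^ 2 * ((N : ℝ) + 1) ^ (1 / 3 : ℝ) * (s' - s))) * (⨆ r ∈ Set.Icc s s', (∫⁻ z, ENNReal.ofReal (((N : ℝ) + 1)⁻¹ * ∑ i : Fin (N + 1), ‖((Φ N).flow r z i).2‖ ^ 2) ∂(Literature.MathematicalPhysics.KineticTheory.localGibbsLaw σ a₀ u₀ θ₀ N (Φ N)))) * (⨆ r ∈ Set.Icc s s', (∫⁻ z, ENNReal.ofReal (((N : ℝ) + 1)⁻¹ * ∑ i : Fin (N + 1), ‖((Φ N).flow r z i).2‖ ^ 3) ∂(Literature.MathematicalPhysics.KineticTheory.localGibbsLaw σ a₀ u₀ θ₀ N (Φ N))))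

/-- glue for the split of `EnergyCurrentTails`: landed theorem `Summit.AtomisticToContinuum.HydrodynamicLimit.Theorems.QuarticSchurLedger.EnergyCurrentTails_of_firstPartner`. -/
theorem EnergyCurrentTailsGlueBy_holds : FirstPartnerFloorMeso → FirstPartnerRealisedShare → EnergyFluxCeilingWindows → EnergyCurrentTails := _root_.Summit.AtomisticToContinuum.HydrodynamicLimit.Theorems.QuarticSchurLedger.EnergyCurrentTails_of_firstPartner

/-- item stmt-AtomisticToContinuum-13022 · crux · rank 4 · open · by planner
why it might fail: needs collision-RATE control of fast particles under the non-equilibrium law (contact pair densities of f_t around fast spheres); channelled fast spheres or transient dense clusters could carry O(1) throughput at polynomially small probability, which entropy bounds cannot see.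
sources: BuragoFerlegerKononenko1998, GST2013, Alexander1975, NachtergaeleYau2003
[crux] VANISHING FAST-COLLISION THROUGHPUT under the true law, pre-shock (the collisional truncation
error of X, in the currency of card apriori-tails-and-rattlers; = retired stmt-6455 verbatim): for
continuous profiles ∃ σ₀ ∀ σ < σ₀ ∀ classical hs-Euler solutions on [0,T) ∀ flow families, if the
local Gibbs fields converge at t = 0 then ∀ t < T ∀ η > 0 ∃ K ∃ N₀ ∀ N ≥ N₀: (N+1)^(-4/3) E[ Σ_i
Σ_(collision times s ≤ t) 1(max(|v_i(s⁻)|,|v_i(s)|) > K) (1 + |v_i(s)+v_i(s⁻)|/2) |v_i(s) − v_i(s⁻)|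
] ≤ η ((N+1)^(4/3) = order of the number of collisions on [0,t]; the summand vanishes unless i
collides at s). [difficulty: L] -/
@[route_item "route-AtomisticToContinuum-BallwiseInvariantReferences", crux]
def FastCollisionThroughput : Prop :=
  ∀ (a₀ θ₀ : Literature.MathematicalPhysics.KineticTheory.T3 → ℝ) (u₀ : Literature.MathematicalPhysics.KineticTheory.T3 → Literature.MathematicalPhysics.KineticTheory.V3), Continuous a₀ → Continuous θ₀ → Continuous u₀ → (∀ x, 0 < a₀ x) → (∀ x, 0 < θ₀ x) → ∃ σ₀ : ℝ, 0 < σ₀ ∧ ∀ σ : ℝ, 0 < σ → σ < σ₀ → ∀ (T : ℝ) (ρ θ : ℝ → Literature.MathematicalPhysics.KineticTheory.T3 → ℝ) (u : ℝ → Literature.MathematicalPhysics.KineticTheory.T3 → Literature.MathematicalPhysics.KineticTheory.V3), Literature.MathematicalPhysics.KineticTheory.IsHardSphereEulerSolution σ T ρ u θ → ∀ Φ : (N : ℕ) → Literature.Analysis.FluidPDE.HardSphereFlow (Literature.Analysis.FluidPDE.Torus.geometry (Fin 3)) (Literature.MathematicalPhysics.KineticTheory.hsDiameter σ N) (N + 1),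 Literature.MathematicalPhysics.KineticTheory.TendstoHydroFieldsAt (fun N => Literature.MathematicalPhysics.KineticTheory.localGibbsLaw σ a₀ u₀ θ₀ N (Φ N)) Φ ρ u θ 0 → ∀ t ∈ Set.Ico 0 T, ∀ η : ℝ, 0 < η → ∃ K : ℝ, ∃ N₀ : ℕ, ∀ N : ℕ, N₀ ≤ N → ∫⁻ z, ENNReal.ofReal ((((N : ℝ) + 1) ^ (-(4 / 3 : ℝ))) * ∑ i : Fin (N + 1), ∑ᶠ s ∈ Literature.Analysis.FluidPDE.collisionTimes (Literature.Analysis.FluidPDE.Torus.geometry (Fin 3)) (Literature.MathematicalPhysics.KineticTheory.hsDiameter σ N) (fun s => (Φ N).flow s z) ∩ Set.Ioc 0 t, (if K < max ‖(Function.leftLim (fun s => (Φ N).flow s z) s i).2‖ ‖((Φ N).flow s z i).2‖ then (1 + ‖((Φ N).flow s z i).2 + (Function.leftLim (fun s => (Φ N).flow s z) s i).2‖ / 2) * ‖((Φ N).flow s z i).2 - (Function.leftLim (fun s => (Φ N).flow s z) s i).2‖ else 0)) ∂(Literature.MathematicalPhysics.KineticTheory.localGibbsLaw σ a₀ u₀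 θ₀ N (Φ N)) ≤ ENNReal.ofReal η

/-- item stmt-AtomisticToContinuum-13023 · crux · rank 5 · open · by planner
why it might fail: window locality under f_t with only cubic-UI tails, the o(N_B) hard-core boundary/ensemble corrections for ball marginals, the parameter/time grids and the inverse equation of state for a_t must all close at o(N); any of these may demand more than items 3–4 supply.
sources: Yau1991, OllaVaradhanYau1993, KipnisLandim1999, Spohn1991
[crux] THE BALL-WISE SUFFICIENCY THEOREM (card crux 2 as an implication; = retired stmt-8346
verbatim): LocalFluxGibbsianity → EnergyCurrentTails → FastCollisionThroughput →
RelEntropyVanishing. Proof plan: Yau's Gronwall for H(f_t | ψ_t) on the torus with ψ_t the local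
Gibbs law driven by the classical solution; quadratic remainder by static LD
(LocalGibbsConcentration 0767-type); for the one-block term tile [0,t] by micro windows
L(N+1)^(-1/3), cover 𝕋³ by balls of radius r with a partition of unity χ_B, test the
collision-resolved recentred current against χ_B∇λ_t (non-gradient, sup-norm ≤ β₀ after choosing the
entropy-inequality parameter a = β₀/sup|∇λ_t|), apply the entropy inequality ball-wise to the
B⁺-marginal of f_t against the marginal of the homogeneous invariant Gibbs law of an (M+1)-sphere
system on the same unit torus with M+1 ≈ ρ_B(N+1) and parameters (σρ_B^(1/3), u_B, θ_B) on an
r-grid; entropy mismatch ≤ N_B(h_B + Cr² + Cr√h_B) + o(N_B) (second order in r; cross term via the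
static entropy inequality), Σ_B N_B h_B ≤ C_ov H + o(N) (superadditivity for near-product hard-core
references), microscopic locality of X_B over the window from deterministic light cones for p -/
@[route_item "route-AtomisticToContinuum-BallwiseInvariantReferences", crux]
def BallwiseSufficiency : Prop :=
  LocalFluxGibbsianity → EnergyCurrentTails → FastCollisionThroughput → RelEntropyVanishing

/-- item stmt-AtomisticToContinuum-0769 · support · rank 9 · closed · proved by Summit.AtomisticToContinuum.HydrodynamicLimit.Theorems.heatBathForgetting_assembly_proof @ 7068fd10e358 (prover) · by planner
sources: KipnisLandim1999, Yau1991
[assembly] X_RE → HydrodynamicLimit: entropy inequality μ(A) ≤ (log 2 + H(μ|λ))/log(1 + 1/λ(A))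
(from Donsker–Varadhan / Mathlib klDiv API) with λ(A) ≤ C e^{-(N+1)/C} and H = o(N) gives μ(A) → 0;
μ = lawAt (Φ N) P t = P.map (flow t) turns μ{z | δ < |field z − ·|} into P{z | δ < |field (flow t z)
− ·|} (measurable_flow); the reference concentration is stated for z itself and TendstoHydroFieldsAt
at time 0 of the reference law is not needed. Zero-mass case impossible by the IsProbabilityMeasure
clauses; take σ₀ from X_RE. -/
@[route_item "route-AtomisticToContinuum-BallwiseInvariantReferences", crux]
def EntropyToFields : Prop :=
  RelEntropyVanishing → Literature.MathematicalPhysics.KineticTheory.HydrodynamicLimit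

/-- `EntropyToFields` holds: proved by `Summit.AtomisticToContinuum.HydrodynamicLimit.Theorems.heatBathForgetting_assembly_proof` @ 7068fd10e358. -/
theorem EntropyToFields_holds : EntropyToFields := _root_.Summit.AtomisticToContinuum.HydrodynamicLimit.Theorems.heatBathForgetting_assembly_proof

/-- item stmt-AtomisticToContinuum-13024 · assembly · rank 1 · closed · proved by Summit.AtomisticToContinuum.HydrodynamicLimit.Theorems.ballwiseInvariantReferences_assembly_proof @ ebc54a093a26 (prover) · by planner
sources: Yau1991, OllaVaradhanYau1993
[assembly] LocalFluxGibbsianity → EnergyCurrentTails → FastCollisionThroughput → BallwiseSufficiency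
→ EntropyToFields → HydrodynamicLimit (proof fun h₁ h₂ h₃ h₄ h₅ => h₅ (h₄ h₁ h₂ h₃)). -/
@[route_item "route-AtomisticToContinuum-BallwiseInvariantReferences"]
def Assembly : Prop :=
  LocalFluxGibbsianity → EnergyCurrentTails → FastCollisionThroughput → BallwiseSufficiency → EntropyToFields → _root_.HydrodynamicLimit

/-! D-0027 §2.1 — DECIDING THEOREM (planner-authored via `route open/edit --closes-file`; by planner-rbadge-AtomisticToContinuum-BallwiseIn-c3c01060-0 2026-08-16T23:49:45Z):
its hypotheses are this route's items and its conclusion the sub-problem Statement (glue_lint), and it elaborates with this file. -/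

@[closes "route-AtomisticToContinuum-BallwiseInvariantReferences"] theorem closes (h₁ : LocalFluxGibbsianity) (h₂ : EnergyCurrentTails) (h₃ : FastCollisionThroughput) (h₄ : BallwiseSufficiency) (h₅ : EntropyToFields) : _root_.HydrodynamicLimit :=
  _root_.HydrodynamicLimit.of_unguarded (h₅ (h₄ h₁ h₂ h₃))

end Summit.AtomisticToContinuum.HydrodynamicLimit.Theses.BallwiseInvariantReferences
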